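/-
Origin: expansion seat `planner-pub-hodgecm-carver-0`, handover 2026-08-18T03:27:49Z (synced 03:34:05Z) (`HOME/pub-hodgecm-carver/lean/Carver/PerL34/Forms.lean`, md5 6662dfd4, 56 lines);
landed by the gen-5 packager in gate run 18 as `HodgeCM/PerL34/Forms.lean` (verbatim).
-/
/-
Origin: HOME/pub-hodgecm-carver/lean/HodgeCM/PerL34/Forms.lean — session planner-pub-hodgecm-carver-0 (unit
pub-hodgecm-carver, THE CARVER).  Intended final place: `HodgeCM/PerL34/Forms.lean`.
DAG nodes (HOME/LEMMAS.md §1): N07 (§3.1 Q-form paragraph, tex ll. 220–222), N08 (Lemma 3.1 `lem:Krat`,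
ll. 223–226), N09 (§3.1 forms paragraph + (eq:Qaut), ll. 239–256).  Nothing is asserted: every node is a named
`Prop`; the `_iff` lemmas record that the node statement IS the package's existing named input (by `Iff.rfl`).
-/
import Summits.HodgeConjecture.HodgeCM.Automorphic.ThetaFacts

set_option autoImplicit false

/-!
# PerL v5 §3.1 — from morphisms to automorphic forms (DAG nodes N07, N08, N09)

* **N07** (tex ll. 220–222): "`Q(u_1,u_2,\bar u_3,\bar u_4):=\int u_1\wedge u_2\wedge\bar u_3\wedge\bar u_4` …
  `Q=\langle u_1\wedge u_2,u_3\wedge u_4\rangle` for the pairing `\langle\eta,\eta'\rangle:=\int\eta\wedge\bar\eta'`,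
  which is positive definite on holomorphic 2-forms."  The definitional half is `Universe.period = trC ∘ quadC`
  (rfl in the package); the positivity half is the PRINT fact `Universe.Fact_hodgeRiemann20` (Voisin I Thm 6.32),
  recorded only as `≠ 0`.
* **N08** (Lemma 3.1, ll. 223–226): "`W^L_{\rm per}(K)` holds if (and only if) there are `(V_3,h)`, a neat `K_f`
  and `u_i\in U_{t^i}(S(K_f))` `(i=1,..,4)` with `Q(u_1,u_2,\bar u_3,\bar u_4)\ne0`."  DEFINITIONAL in the package:
  `Universe.PerL` (StubTree/Reduction) is already typed in this "Krat form" (`u_i ∈ Uiso`, `period ≠ 0`), see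
  DIVERGENCE.md F1/F2; no separate statement is needed and none is made.
* **N09** (ll. 239–256): holomorphic forms as `K_∞`-equivariant automorphic functions (Matsushima; [BW] VII),
  the wedge as the scalar function `u_1^1u_2^2-u_1^2u_2^1`, `\langle\eta,\eta'\rangle=c_{K_f}\int_{[G_U]}\eta\bar\eta'`,
  and (eq:Qaut).  In the package these are the two PRINT-interface facts of the theta model:
  `Fact_embCover` (level independence) and `Fact_innerEmb` (Petersson = cup pairing, `c_Γ ≠ 0`).
-/

namespace HodgeCM
namespace PerL34

variable {U : Universe} (T : U.ThetaModel)

/-- **N07** (PerL v5 §3.1, tex ll. 220–222, positivity clause): "the pairing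
`\langle\eta,\eta'\rangle:=\int\eta\wedge\bar\eta'` … is positive definite on holomorphic `2`-forms" — recorded
normalisation-free as non-vanishing of `∫ η ∪ η̄` for `0 ≠ η ∈ F²H²` on a surface. PRINT (Voisin I Thm 6.32). -/
def N07_hodgeRiemann20 (U : Universe) : Prop := U.Fact_hodgeRiemann20

/-- (Ported verbatim from the HodgeCMPerL package; no docstring in the source.) -/
theorem N07_iff (U : Universe) : N07_hodgeRiemann20 U ↔ U.Fact_hodgeRiemann20 := Iff.rfl

/-- **N09a** (PerL v5 §3.1, tex ll. 241–245 + (eq:Qaut) ll. 249–256, level independence): "Holomorphic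
`1`-forms (resp. `2`-forms) on `S(K_f)` are the elements of
`(C^\infty(G_U(L_0)\backslash G_U(\A)/K_f)\otimes\wedge^p\tau)^{K_\infty}` … annihilated by `\fp_-`" — whence the
`L²` function of a class does not change under pull-back to smaller level.  PRINT-interface ([BW] VII §2). -/
def N09a_embCover : Prop := T.Fact_embCover

/-- **N09b** (PerL v5 §3.1, tex l. 244: "`\langle\eta,\eta'\rangle=c_{K_f}\int_{[G_U]}\eta(g)\ol{\eta'(g)}\,dg`
with `c_{K_f}>0`", Matsushima; [BW] VII Thm 3.2).  Recorded with `c_Γ ≠ 0`.  PRINT-interface. -/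
def N09b_innerEmb : Prop := T.Fact_innerEmb

/-- (Ported verbatim from the HodgeCMPerL package; no docstring in the source.) -/
theorem N09a_iff : N09a_embCover T ↔ T.Fact_embCover := Iff.rfl
/-- (Ported verbatim from the HodgeCMPerL package; no docstring in the source.) -/
theorem N09b_iff : N09b_innerEmb T ↔ T.Fact_innerEmb := Iff.rfl

end PerL34
end HodgeCM
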